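import Summits.ValiantsHypothesis.ValiantsHypothesis.Theorems.GrenetZeonTwoDimCoefficientsDefs

/-!
# `GrenetZeon.DualUnipotentThreeHalves` (stmt-ValiantsHypothesis-24318) — line «radical_split»: the VOCABULARY of the
# flag-cost / Wedderburn-split line and of its §7 word–flag duality and §8 finite-instance table (definitions only)

Port (val-lit merged desk, b71 (B) port pool; porter val-port-1 g2; texts = val-idea-9 g3/g4's, credited) of the
DEFINITIONS of the crux workfile `Cruxes/DualUnipotentThreeHalves/Lines/radical_split.lean` @749d8538785a that the
Theorems-side ports of its §7 (word–flag duality) and §8 (finite instances of R2) speak about.  Crux workfiles are not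
importable from `Theorems/` (lint.import), so the vocabulary is re-landed here VERBATIM (same names, same bodies) under
`…Theorems.GrenetZeon.RadicalSplit`; every definition below is DEFINITIONALLY EQUAL to its workfile twin, so the line
wires the ported theorems by `exact` (δ-unfolding), and may later alias its own copies to these.

* §0–§1b of the line (val-idea-9 g3): `lineSubst` (substitution along a line `x + s·v`), `flagDeg`, `FlagAdapted`,
  `FlagAdaptedUpTo`, `FlagCheap` (the flag-cost certificate), `FlagCostLaw` (S3b — the line's OPEN law, a `Prop`,
  never asserted), `pencilAlg`, `linPart` (`N_lin(v) = N(v) − N(0)`), `RadOrth`, `HeavyTopLaw` (R2 — the residual LAW of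
  the line = the crux of 24318 in this line's currency; a `Prop`, never asserted).
* §7 (val-idea-9 g4): `word`, `WordTame` (the dual currency of `FlagAdaptedUpTo`), `WordCheap`, `FlagCostWordLaw`,
  `HeavyTopWordLaw`.
* §8 (val-idea-9 g4): `HeavyTopInst n m` (R2 at ONE format), `SqZeroInSix` (Gerstenhaber's equality case at `4 × 4`,
  TRUE in print [Gerstenhaber 1958 Thm 2; de Seguins Pazzis 2013 Thm 1], not yet in the tree — the Literature typing is
  val-lit's P-iii), `linPencil`, and the explicit `(3,5)` witness data `topFive`, `NFive`, `vZero`.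

`AffMat n m = Matrix (Fin m) (Fin m) (MvPolynomial (Fin n × Fin n) ℂ)` and `IsAffine` are the tree's
(`…GrenetZeonTwoDimCoefficientsDefs`, `DimTwoCases.AffMat` / `DimTwoCases.IsAffine`).

Honest framing.  DEFINITIONS ONLY (`--supports stmt-ValiantsHypothesis-24318 --as helper`); nothing here asserts S3b, R2,
the crux `DualUnipotentThreeHalves`, rung 8062 or `VP ≠ VNP` — all untouched / NOT proved.  The laws are `Prop`s to be
used as HYPOTHESES or as targets of instance theorems (`HeavyTopInst`), exactly as in the workfile.
-/

-- `Summit.ValiantsHypothesis.ValiantsHypothesis.…` repeats a component by the D-0017 layout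
-- (single-conjunct summit), which the `dupNamespace` linter flags; the name is mandated.
set_option linter.dupNamespace false

noncomputable section

namespace Summit.ValiantsHypothesis.ValiantsHypothesis.Theorems.GrenetZeon.RadicalSplit

open MvPolynomial Matrix
open scoped BigOperators
open Summit.ValiantsHypothesis.ValiantsHypothesis.Cruxes.TwoDimCoefficients.DimTwoCases (AffMat IsAffine)

/-! ## §0–§1b The flag-cost vocabulary of the line (val-idea-9 g3) -/

/-- The substitution `X_c ↦ x_c + v_c · s` into one-variable polynomials (`s = X 0`). -/
def lineSubst {σ : Type*} (x v : σ → ℂ) : MvPolynomial σ ℂ →ₐ[ℂ] MvPolynomial (Fin 1) ℂ :=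
  aeval fun c => (C (x c) + ∑ t : Fin 1, C (v c) * X t : MvPolynomial (Fin 1) ℂ)

/-- Degree budget of a flag with `p` levels, drop `r`, climb weight `a+1`, over words of length `n-1`. -/
def flagDeg (p r a n : ℕ) : ℕ := (p - 1 + r * (n - 1)) / (a + 1)

/-- `M(s)` is ADAPTED to the levels `lvl` with drop `r` and weight `a+1`: the `s^e`-part of the `(i,j)` entry
is nonzero only if `(a+1)·e + lvl j ≤ lvl i + r`.  (`e = 0`: the constant part lowers the level by at most
`r`; `e = 1`: the linear part raises it by at least `a+1-r`; for the census instances `a = r`, climb `1`.) -/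
def FlagAdapted {m : ℕ} (lvl : Fin m → ℕ) (r a : ℕ) (M : Matrix (Fin m) (Fin m) (MvPolynomial (Fin 1) ℂ)) :
    Prop :=
  ∀ (i j : Fin m) (d : Fin 1 →₀ ℕ), coeff d (M i j) ≠ 0 → (a + 1) * d 0 + lvl j ≤ lvl i + r

/-- `M(s)` is adapted, after a constant change of basis, to SOME flag of degree budget `≤ k`. -/
def FlagAdaptedUpTo (m k n : ℕ) (M : Matrix (Fin m) (Fin m) (MvPolynomial (Fin 1) ℂ)) : Prop :=
  ∃ (g : (Matrix (Fin m) (Fin m) ℂ)ˣ) (lvl : Fin m → ℕ) (p r a : ℕ),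
    (∀ i, lvl i < p) ∧ flagDeg p r a n ≤ k ∧
    FlagAdapted lvl r a ((g : Matrix (Fin m) (Fin m) ℂ).map C * M * (↑g⁻¹ : Matrix (Fin m) (Fin m) ℂ).map C)

/-- The pencil `N` is FLAG-CHEAP: some direction space `K` and order `k` with `(k+1)·n < dim K` such that
along every line `x + s v`, `v ∈ K`, the substituted pencil is adapted (up to a constant change of basis that
may depend on the line) to a flag of budget `≤ k`.  The INVARIANT of the verdict is
`κ(N) := min over (K, flags) of codim K + (k+1)·n`; flag-cheap means `κ(N) < n²`. -/
def FlagCheap (n m : ℕ) (N : AffMat n m) : Prop :=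
  ∃ (K : Submodule ℂ (Fin n × Fin n → ℂ)) (k : ℕ),
    (∀ x v : Fin n × Fin n → ℂ, v ∈ K → FlagAdaptedUpTo m k n (N.map (lineSubst x v))) ∧
    (k + 1) * n < Module.finrank ℂ K

/-- **S3b — FLAG-COST LAW** (per-agnostic; the residual crux of `flag_cost`; in THIS line it is DERIVED
from R1 + R2 by `flagCostLaw_of_split`).  Every affine nilpotent
`m × m` pencil over `Mat_n(ℂ)` with `C₀·m² < n³` is flag-cheap.  TRUE on every family of the wild census
(one uniform flag each, see the module docstring); content only for coefficient spaces of dimension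
`δ ≥ n² - n`.  Why it might fail: an irreducible-top-heavy nilpotent space at `δ ≈ m^{4/3}` expensive for every
bounded-drop flag, or a pencil slow only by cancellation. [this line; MOR 1991; crit-3 #9/#14; GMS 2023] -/
def FlagCostLaw : Prop :=
  ∃ C₀ n₀ : ℕ, ∀ n ≥ n₀, ∀ m : ℕ, C₀ * m ^ 2 < n ^ 3 → ∀ N : AffMat n m, IsAffine N → N ^ m = 0 →
    FlagCheap n m N

/-- The unital matrix algebra `𝒜(N)` generated by the values `N(x)`, `x ∈ ℂ^{n×n}`, of the pencil. -/
def pencilAlg {n m : ℕ} (N : AffMat n m) : Subalgebra ℂ (Matrix (Fin m) (Fin m) ℂ) :=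
  Algebra.adjoin ℂ (Set.range fun x : Fin n × Fin n → ℂ => N.map (MvPolynomial.eval x))

/-- Linear part of the pencil in direction `v`: `N(v) − N(0)`. -/
def linPart {n m : ℕ} (N : AffMat n m) (v : Fin n × Fin n → ℂ) : Matrix (Fin m) (Fin m) ℂ :=
  N.map (MvPolynomial.eval v) - N.map (MvPolynomial.eval 0)

/-- `K` is TRACE-ORTHOGONAL to the pencil algebra: `tr(N_lin(v)·b) = 0` for `v ∈ K`, `b ∈ 𝒜(N)`;
equivalently (trace-form characterisation of the radical, char 0) `N_lin(K) ⊆ rad 𝒜(N)`. -/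
def RadOrth (n m : ℕ) (N : AffMat n m) (K : Submodule ℂ (Fin n × Fin n → ℂ)) : Prop :=
  ∀ v ∈ K, ∀ b ∈ pencilAlg N, Matrix.trace (linPart N v * b) = 0

/-- **R2 — HEAVY-TOP LAW** (the residual crux of this line; LAW tier): below `C₀m² < n³`, a nilpotent
pencil all of whose trace-orthogonal direction spaces are small (semisimple-top-heavy) is flag-cheap.
[this line; MOR 1991; de Seguins Pazzis 2025; crit-3 #9/#14/#14a] -/
def HeavyTopLaw : Prop :=
  ∃ C₀ n₀ : ℕ, ∀ n ≥ n₀, ∀ m : ℕ, C₀ * m ^ 2 < n ^ 3 → ∀ N : AffMat n m, IsAffine N → N ^ m = 0 →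
    (∀ K : Submodule ℂ (Fin n × Fin n → ℂ), RadOrth n m N K →
      Module.finrank ℂ K ≤ 16 * m * Nat.sqrt n + 16 * n) →
    FlagCheap n m N

/-! ## §7 Word currency (val-idea-9 g4) -/

variable {m : ℕ}

/-- The word of a Boolean list in two matrices (`true ↦ T₁`, `false ↦ T₀`; the convention of p613488). -/
def word (T₀ T₁ : Matrix (Fin m) (Fin m) ℂ) (w : List Bool) : Matrix (Fin m) (Fin m) ℂ :=
  (w.map fun b => if b then T₁ else T₀).prod

/-- **WORD-TAME with budget `k`** (the dual currency of `FlagAdaptedUpTo`): some climb `c ≥ 1`, drop `r` and height `Θ`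
with `⌊(Θ + r(n−1))/(c+r)⌋ ≤ k` such that every NONZERO word has `c·#T₁ ≤ Θ + r·#T₀`. -/
def WordTame (n k : ℕ) (T₀ T₁ : Matrix (Fin m) (Fin m) ℂ) : Prop :=
  ∃ r c Θ : ℕ, 1 ≤ c ∧ (Θ + r * (n - 1)) / (c + r) ≤ k ∧
    ∀ w : List Bool, word T₀ T₁ w ≠ 0 → c * w.count true ≤ Θ + r * w.count false

/-- **`WordCheap`**: the word-currency twin of `FlagCheap` — a direction space `K` with `(k+1)·n < dim K` on whose lines
every pair `(N(x), N_lin(v))` is word-tame with budget `k`.  Equal to `FlagCheap` for affine `N` (`flagCheap_iff_wordTame`). -/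
def WordCheap (n m : ℕ) (N : AffMat n m) : Prop :=
  ∃ (K : Submodule ℂ (Fin n × Fin n → ℂ)) (k : ℕ), (k + 1) * n < Module.finrank ℂ K ∧
    ∀ x v : Fin n × Fin n → ℂ, v ∈ K → WordTame n k (N.map (MvPolynomial.eval x)) (linPart N v)

/-- **S3b in word currency** (`FlagCostLaw` with `FlagCheap` replaced by `WordCheap`). -/
def FlagCostWordLaw : Prop :=
  ∃ C₀ n₀ : ℕ, ∀ n ≥ n₀, ∀ m : ℕ, C₀ * m ^ 2 < n ^ 3 → ∀ N : AffMat n m, IsAffine N → N ^ m = 0 →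
    WordCheap n m N

/-- **R2 in word currency** (`HeavyTopLaw` with `FlagCheap` replaced by `WordCheap`): on heavy-top thin affine nilpotent
pencils some `K` of dimension `> (k+1)·n` carries only word-tame pairs.  This is the statement a prover attacks by
exhibiting profiles `(r, c, Θ)` and a refuter attacks by exhibiting `M₁`-rich nonzero short words (`not_flagCheap_of_words`). -/
def HeavyTopWordLaw : Prop :=
  ∃ C₀ n₀ : ℕ, ∀ n ≥ n₀, ∀ m : ℕ, C₀ * m ^ 2 < n ^ 3 → ∀ N : AffMat n m, IsAffine N → N ^ m = 0 →
    (∀ K : Submodule ℂ (Fin n × Fin n → ℂ), RadOrth n m N K →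
      Module.finrank ℂ K ≤ 16 * m * Nat.sqrt n + 16 * n) →
    WordCheap n m N

/-! ## §8 The finite instances of R2 and the `(3,5)` witness data (val-idea-9 g4) -/

/-- **The instance of R2 at format `(n, m)`** (the body of `HeavyTopLaw`). -/
def HeavyTopInst (n m : ℕ) : Prop :=
  ∀ N : AffMat n m, IsAffine N → N ^ m = 0 →
    (∀ K : Submodule ℂ (Fin n × Fin n → ℂ), RadOrth n m N K → Module.finrank ℂ K ≤ 16 * m * Nat.sqrt n + 16 * n) →
    FlagCheap n m N

/-- **Gerstenhaber's equality case at `m = 4`, in the form the first open instance needs**: every `6`-dimensional linear space of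
nilpotent `4 × 4` complex matrices contains a `4`-dimensional subspace of square-zero matrices.  TRUE IN PRINT (such a space is
conjugate to `𝔫₄ ⊇ span{E₁₃, E₁₄, E₂₃, E₂₄}`) [Gerstenhaber 1958, Thm. 2; de Seguins Pazzis 2013, Thm. 3]; NOT yet a tree fact. -/
def SqZeroInSix : Prop :=
  ∀ V : Submodule ℂ (Matrix (Fin 4) (Fin 4) ℂ), (∀ A ∈ V, IsNilpotent A) → Module.finrank ℂ V = 6 →
    ∃ W : Submodule ℂ (Matrix (Fin 4) (Fin 4) ℂ), W ≤ V ∧ 4 ≤ Module.finrank ℂ W ∧ ∀ Q ∈ W, Q * Q = 0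

/-- The linear pencil `x ↦ Σ_c x_c • B_c` as an affine pencil. -/
def linPencil {n : ℕ} (B : Fin n × Fin n → Matrix (Fin m) (Fin m) ℂ) : AffMat n m :=
  ∑ c, (MvPolynomial.X c : MvPolynomial (Fin n × Fin n) ℂ) • (B c).map MvPolynomial.C

/-- The top space `𝔫₅ ∩ {a₁₅ = 0}` parametrised by `ℂ^{3×3}`. -/
def topFive (v : Fin 3 × Fin 3 → ℂ) : Matrix (Fin 5) (Fin 5) ℂ :=
  !![0, v (0,0), v (0,1), v (0,2), 0;
     0, 0, v (1,0), v (1,1), v (1,2);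
     0, 0, 0, v (2,0), v (2,1);
     0, 0, 0, 0, v (2,2);
     0, 0, 0, 0, 0]

/-- The linear `5 × 5` pencil over `ℂ^{3×3}` with `N(x) = topFive x`. -/
def NFive : AffMat 3 5 :=
  !![0, MvPolynomial.X (0,0), MvPolynomial.X (0,1), MvPolynomial.X (0,2), 0;
     0, 0, MvPolynomial.X (1,0), MvPolynomial.X (1,1), MvPolynomial.X (1,2);
     0, 0, 0, MvPolynomial.X (2,0), MvPolynomial.X (2,1);
     0, 0, 0, 0, MvPolynomial.X (2,2);
     0, 0, 0, 0, 0]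

/-- The witness direction: `v₀ = e₁₃ + e₃₅` in coordinates, `topFive v₀ = E₁₃ + E₃₅`. -/
def vZero : Fin 3 × Fin 3 → ℂ := fun c => if c = (0,1) then 1 else if c = (2,1) then 1 else 0


end Summit.ValiantsHypothesis.ValiantsHypothesis.Theorems.GrenetZeon.RadicalSplit

end
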